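import Summits.NavierStokesRegularity.NavierStokesRegularity.Theorems.LerayQuarterDissipationFiniteDissipationLiouvilleCalmSliceForward
import Summits.NavierStokesRegularity.NavierStokesRegularity.Theorems.SymmetryModuliCountSymmetricLiouvilleRotationCovariance
import Literature.Analysis.FluidPDE.AxisymmetricVorticityTransport
import Mathlib.MeasureTheory.Measure.Haar.InnerProductSpace
import HarnessLib

/-!
# Route `CalmSliceGate`, crux `OneSymmetricSlice` (stmt-NavierStokesRegularity-24452):
# three registered stubs — isometry pullback, rotation pullback, forward mild uniqueness

Theorems file of route `CalmSliceGate` (seat ns-lqd-p2 g4, cell ns-idea-3; `--supports` the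
crux `OneSymmetricSlice`, skeleton rev 2 of planner ns-idea-3 g3). It proves VERBATIM three of
the five registered stubs of the line:

* `stub_isometryPullback` — **O(3)-covariance of the finite-dissipation stratum**: for a linear
  isometry `g` of `ℝ³`, the pullback `y ↦ g⁻¹ (w(t, g y))` of a Type-I ancient mild field `w`
  (KNSS gauge, constant `C`) is again one (tree: `isTypeIAncientMild_conj_linearIsometryEquiv`,
  the Oseen kernel and the heat flow are isometry-covariant), and the dissipation law
  `∫‖∇w(s)‖² ≤ K/√(−s)` is preserved (`‖g⁻¹ ∘ Dw(gy) ∘ g‖ ≤ ‖Dw(gy)‖`, Lebesgue measure is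
  `g`-invariant);
* `stub_rotationPullback` — the special case of the rotations `R_θ` about the `x₃`-axis
  (`rotZLIE θ`);
* `stub_forwardMildUniqueness` — **forward uniqueness in the class from one slice**: two Type-I
  ancient mild fields with the same constant and the same slice at `t = −1` agree on
  `[−1, 0) × ℝ³` (uniqueness of bounded solutions of the Oseen integral equation on every
  window `(−1, t₁)`, `t₁ < 0`, Literature `oseenMild_bounded_unique`, KNSS 2009 §4; slices are
  continuous).

Navier–Stokes regularity is NOT proved here; no summit is. The two remaining stubs of the line
(`stub_symmetricLimit`, `stub_axisymTypeIExclusionStd`) are not touched by this file.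
-/

noncomputable section

-- the summit and its single sub-problem share the name (CONVENTIONS §1), as in every Theorems file
set_option linter.dupNamespace false

namespace Summit.NavierStokesRegularity.NavierStokesRegularity.Theorems.OneSymmetricSlice.Birth

open MeasureTheory Set Filter Topology Metric Function
open Literature.Analysis Literature.Analysis.FluidPDE Literature.Analysis.UnboundedOperators
open scoped ENNReal NNReal

/-! ### O(3)-covariance of the stratum -/

/-- **The dissipation integrand of an isometric pullback is dominated by the original one**:
`‖D(g⁻¹ ∘ f ∘ g)(y)‖ ≤ ‖Df(g y)‖` for a linear isometry `g` (chain rule in the hypothesis-free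
forms `ContinuousLinearEquiv.comp_fderiv` / `comp_right_fderiv`; isometries have operator norm
`≤ 1`). [folklore] -/
theorem norm_fderiv_conj_le (g : EuclideanSpace ℝ (Fin 3) ≃ₗᵢ[ℝ] EuclideanSpace ℝ (Fin 3))
    (f : EuclideanSpace ℝ (Fin 3) → EuclideanSpace ℝ (Fin 3)) (y : EuclideanSpace ℝ (Fin 3)) :
    ‖fderiv ℝ (fun y => g.symm (f (g y))) y‖ ≤ ‖fderiv ℝ f (g y)‖ := by
  have e : (fun y => g.symm (f (g y))) =
      (g.symm.toContinuousLinearEquiv : EuclideanSpace ℝ (Fin 3) → EuclideanSpace ℝ (Fin 3)) ∘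
        (f ∘ (g.toContinuousLinearEquiv : EuclideanSpace ℝ (Fin 3) → EuclideanSpace ℝ (Fin 3))) := by
    funext y; simp
  rw [e, ContinuousLinearEquiv.comp_fderiv, ContinuousLinearEquiv.comp_right_fderiv]
  refine (ContinuousLinearMap.opNorm_comp_le _ _).trans ?_
  refine (mul_le_mul (g.symm.toLinearIsometry.norm_toContinuousLinearMap_le) 
    ((ContinuousLinearMap.opNorm_comp_le _ _).trans (mul_le_of_le_one_right (norm_nonneg _)
      g.toLinearIsometry.norm_toContinuousLinearMap_le)) (norm_nonneg _) zero_le_one).trans ?_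
  simp

/-- **`stub_isometryPullback`** (registered stub of `OneSymmetricSlice`, skeleton rev 2): the
pullback `y ↦ g⁻¹(w(t, g y))` of a member of the finite-dissipation stratum `𝒟_{C,K}` by a
linear isometry `g` of `ℝ³` is a member of `𝒟_{C,K}` — the class is `O(3)`-covariant
(`isTypeIAncientMild_conj_linearIsometryEquiv`) and so is the law (`‖D(g⁻¹wg)‖ ≤ ‖Dw‖ ∘ g`,
invariance of Lebesgue measure under `g`). [cite: KochNadirashviliSereginSverak2009, §1 p. 3 (arXiv:0709.3599): symmetries of the problem] -/
theorem stub_isometryPullback (C K : ℝ)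
    (w : ℝ → EuclideanSpace ℝ (Fin 3) → EuclideanSpace ℝ (Fin 3)) (hw : IsTypeIAncientMild C w)
    (hD : ∀ s : ℝ, s < 0 → ∫⁻ x, ‖fderiv ℝ (w s) x‖ₑ ^ 2 ≤ ENNReal.ofReal (K / Real.sqrt (-s)))
    (g : EuclideanSpace ℝ (Fin 3) ≃ₗᵢ[ℝ] EuclideanSpace ℝ (Fin 3)) :
    IsTypeIAncientMild C (fun t y => g.symm (w t (g y))) ∧
      (∀ s : ℝ, s < 0 →
        ∫⁻ y, ‖fderiv ℝ (fun y => g.symm (w s (g y))) y‖ₑ ^ 2 ≤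
          ENNReal.ofReal (K / Real.sqrt (-s))) := by
  refine ⟨?_, fun s hs => ?_⟩
  · have h := SymmetryModuliCountSymmetricLiouville.isTypeIAncientMild_conj_linearIsometryEquiv hw g.symm
    simpa only [LinearIsometryEquiv.symm_symm] using h
  · calc ∫⁻ y, ‖fderiv ℝ (fun y => g.symm (w s (g y))) y‖ₑ ^ 2
        ≤ ∫⁻ y, ‖fderiv ℝ (w s) (g y)‖ₑ ^ 2 := by
          refine lintegral_mono fun y => ?_
          gcongr
          rw [← ofReal_norm, ← ofReal_norm]
          exact ENNReal.ofReal_le_ofReal (norm_fderiv_conj_le g (w s) y)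
      _ = ∫⁻ y, ‖fderiv ℝ (w s) y‖ₑ ^ 2 :=
          g.measurePreserving.lintegral_comp_emb g.toHomeomorph.measurableEmbedding
            (fun y => ‖fderiv ℝ (w s) y‖ₑ ^ 2)
      _ ≤ ENNReal.ofReal (K / Real.sqrt (-s)) := hD s hs

/-- **`stub_rotationPullback`** (registered stub of `OneSymmetricSlice`, skeleton rev 2): the
conjugate `y ↦ R_{−θ}(w(t, R_θ y))` of a Type-I ancient mild field by the rotation `R_θ` about
the `x₃`-axis is a Type-I ancient mild field with the same constant (the case `g = R_θ` of the
isometry covariance, `rotZLIE θ`). [cite: KochNadirashviliSereginSverak2009, §1 p. 3 (arXiv:0709.3599): symmetries of the problem] -/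
theorem stub_rotationPullback (C : ℝ)
    (w : ℝ → EuclideanSpace ℝ (Fin 3) → EuclideanSpace ℝ (Fin 3)) (hw : IsTypeIAncientMild C w)
    (θ : ℝ) : IsTypeIAncientMild C (fun t y => rotZ (-θ) (w t (rotZ θ y))) := by
  have h := SymmetryModuliCountSymmetricLiouville.isTypeIAncientMild_conj_linearIsometryEquiv hw (rotZLIE θ).symm
  simpa only [LinearIsometryEquiv.symm_symm, rotZLIE_apply, rotZLIE_symm_apply] using h

/-! ### Forward uniqueness in the class from one slice -/

/-- **`stub_forwardMildUniqueness`** (registered stub of `OneSymmetricSlice`, skeleton rev 2):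
two Type-I ancient mild fields (KNSS gauge, common constant `C`) with the same slice at `t = −1`
coincide on `[−1, 0) × ℝ³`. On each window `(−1, t₁)`, `t₁ < 0`, both are bounded by `C/√(−t₁)`,
jointly measurable, and solve the Oseen integral equation with the same free term
`e^{(t+1)Δ} w₁(−1) = e^{(t+1)Δ} w₂(−1)`, so they agree a.e. (`oseenMild_bounded_unique`,
KNSS 2009 §4), hence everywhere by continuity of the slices. [cite: KochNadirashviliSereginSverak2009, §4 (4.3)–(4.4) (arXiv:0709.3599 p. 8)] -/
theorem stub_forwardMildUniqueness (C : ℝ)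
    (w₁ w₂ : ℝ → EuclideanSpace ℝ (Fin 3) → EuclideanSpace ℝ (Fin 3))
    (h₁ : IsTypeIAncientMild C w₁) (h₂ : IsTypeIAncientMild C w₂)
    (heq : ∀ x, w₁ (-1) x = w₂ (-1) x) :
    ∀ t ∈ Set.Ico (-1 : ℝ) 0, ∀ x, w₁ t x = w₂ t x := by
  intro t ht x
  rcases eq_or_lt_of_le ht.1 with h | h
  · rw [← h]; exact heq x
  -- the window `(-1, t₁)`, `t < t₁ < 0`
  set t₁ : ℝ := t / 2 with ht₁
  have ht₁0 : t₁ < 0 := by rw [ht₁]; linarith [ht.2]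
  have htt₁ : t < t₁ := by rw [ht₁]; linarith [ht.2]
  have hM : 0 ≤ C / Real.sqrt (-t₁) := div_nonneg h₁.nonneg (Real.sqrt_nonneg _)
  have hslice : w₁ (-1) = w₂ (-1) := funext heq
  have hu : ∀ s ∈ Ioo (-1 : ℝ) t₁, w₁ s =ᵐ[volume]
      fun y => heatFlow (w₁ (-1)) (s - (-1)) y - oseenDuhamel 1 (-1) w₁ w₁ s y :=
    fun s hs => Eventually.of_forall fun y => h₁.mild_eq hs.1 (hs.2.trans ht₁0) y
  have hv : ∀ s ∈ Ioo (-1 : ℝ) t₁, w₂ s =ᵐ[volume]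
      fun y => heatFlow (w₁ (-1)) (s - (-1)) y - oseenDuhamel 1 (-1) w₂ w₂ s y :=
    fun s hs => Eventually.of_forall fun y => by
      rw [hslice]; exact h₂.mild_eq hs.1 (hs.2.trans ht₁0) y
  have huniq := oseenMild_bounded_unique (E := EuclideanSpace ℝ (Fin 3)) (ν := 1) (u := w₁)
    (v := w₂) one_pos hM
    (h₁.aestronglyMeasurable_uncurry (s := -1) ht₁0.le)
    (h₂.aestronglyMeasurable_uncurry (s := -1) ht₁0.le)
    (fun τ hτ y => h₁.norm_le_of_mem_Ioo ht₁0 hτ y)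
    (fun τ hτ y => h₂.norm_le_of_mem_Ioo ht₁0 hτ y) hu hv t ⟨h, htt₁⟩
  have heqt : w₁ t = w₂ t :=
    (Continuous.ae_eq_iff_eq volume (h₁.continuous_slice ht.2) (h₂.continuous_slice ht.2)).1 huniq
  exact congrFun heqt x

end Summit.NavierStokesRegularity.NavierStokesRegularity.Theorems.OneSymmetricSlice.Birth

end
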